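import Mathlib
import Literature.Computability.AlgebraicComplexity.NewtonPolygonTauProductBounds
import HarnessLib

/-!
# Crux `NewtonUnitEquations.DissociatedUniform` (stmt-ValiantsHypothesis-5905): the `n = 3` TOTALS LAW of model (Q**) — typed statement

Model (Q**) of the disprover census `Cruxes/DissociatedUniform/NOTES-d1g3.md` (@26a3efc54207, kit j298398): a finite abelian
group `G` (`q = |G|`; the census takes `G = ℤ/q`), three "curves" `a b c : G → ℝ²` (coordinate `j` of the frame has the `q`
letters `x ∈ G`, letter `x` carrying the label `x` and the exponent `a x`, resp. `b x`, `c x`), and for every class `s ∈ G` the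
planar point set
`class s = {a x + b y + c z : x + y + z = s}` (`q²` words).  `V_s` is the number of vertices (extreme points) of the convex hull
of class `s` and `T(a,b,c) = ∑_s V_s` the TOTAL vertex count.  By the design dictionary
(`ShadowVerticesDesign.fshadow_eq_classVertexWords`) `T` is exactly the size of the frame shadow of the corresponding
character design with `n = 3` coordinates, so `T` super-polynomial in `q` would refute `stub_smallShadow` by name, while a
TOTALS LAW `T ≤ C·q²` is the first rung (no Gomory crutch, large alphabets) of the missing "average inheritance multiplicity
`O(1)`" theorem (c8-J5 (L1)) that would feed the union/Minkowski recursion (memo §2 L1) with a polynomial instead of Theorem Q's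
quasi-polynomial.

What is here (definitions + conjecture-grade statements + the rigorous envelope; NO claim that the law is proved):
* `TotalsLaw.classPts a b c s`, `TotalsLaw.classVert a b c s = V_s`, `TotalsLaw.totalVert a b c = T(a,b,c)`; the pair-sumset
  fibres `TotalsLaw.fibrePts a b r = P_r = {a x + b (r - x)}`, `fibreVert`, `fibreTotal a b = ∑_r V(P_r)` (`V_P`; `V_Q`, `V_R` by rotation).
* `TotalsLawThree C` : for every finite abelian `G` and all `a b c`, `T ≤ C · |G|²`  (OPEN; census: `T ≤ 2.00·q²` on 1484
  structured families per `q ≤ 31` and under annealing, both extreme regimes provably `≤ 2q²`, memo §2 L5);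
  `SharpTotalsLawThree C` : `T ≤ 2|G|² + C|G|` (memo §3); `TotalsLawThreeCyclic C` : the literal (Q**) case `G = ZMod q`;
  `FibreSumDominance C` : `T ≤ V_P + V_Q + V_R + C|G|` (this seat's census-sharp refinement).  All `def … : Prop`, never asserted.
* PROVED: `V_s ≤ |G|²`, `T ≤ |G|³`, `V(P_r) ≤ |G|`, `∑_r V(P_r) ≤ |G|²`; class `=` union of translated fibres; the symmetries
  `T(a,b,c) = T(b,c,a) = T(b,a,c)`; **memo L1** `classVert_le_fibreTotal_add_card : V_s ≤ ∑_r V(P_r) + |G|` (and through `Q`, `R`),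
  hence `T ≤ |G|(V_P + |G|)`; **memo L5** `le_of_wins_all` (full multiplicity ⇒ top fibre) with its quantitative form
  `sum_sub_le_card_mul_of_wins`; the degenerate regime `totalVert_const_le : c constant ⇒ T ≤ 2|G|² + |G|`; the implications
  sharp ⇒ weak, general ⇒ cyclic, fibre-sum dominance ⇒ weak.  Convex-geometry engine reused by name: the tree's planar Minkowski
  vertex bound `KPTT.PlanarMinkowski.ncard_extremePoints_add_le` and `…_biUnion_le` (Literature, NewtonPolygonTauProductBounds).
Deliberately NOT here: injectivity of the curves is not assumed (the census curves are injective; collapsing letters only merges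
blobs), and nothing is claimed about `n ≥ 4` (general conjecture `T(n) ≤ (n-1)·t·q + O_n(q)`, memo §3).
[folklore: extreme points of the hull of a finite set lie in the set]
-/

set_option linter.dupNamespace false -- `ValiantsHypothesis.ValiantsHypothesis` (summit = problem) in every name

open scoped BigOperators Pointwise

namespace Summit.ValiantsHypothesis.ValiantsHypothesis.Theorems.NewtonUnitEquationsDissociatedUniform

namespace TotalsLaw

variable {G : Type*} [AddCommGroup G] [Fintype G]

/-- The point set of the label class `s` in model (Q**) with `n = 3` coordinates: all points `a x + b y + c z` with
`x + y + z = s` (parametrised by `(x, y) ∈ G × G`, `z = s - x - y`). -/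
def classPts (a b c : G → (Fin 2 → ℝ)) (s : G) : Set (Fin 2 → ℝ) :=
  Set.range fun p : G × G => a p.1 + b p.2 + c (s - p.1 - p.2)

/-- `V_s`: the number of vertices (extreme points of the convex hull) of the class `s`. -/
noncomputable def classVert (a b c : G → (Fin 2 → ℝ)) (s : G) : ℕ :=
  (Set.extremePoints ℝ (convexHull ℝ (classPts a b c s))).ncard

/-- `T(a,b,c) = ∑_s V_s`: the total number of class-hull vertices over all `|G|` classes. -/
noncomputable def totalVert (a b c : G → (Fin 2 → ℝ)) : ℕ :=
  ∑ s, classVert a b c s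

/-- The fibre `P_r = {a x + b (r - x) : x ∈ G}` of the pair sumset `a(G) + b(G)` over `r` (so that class `s` is the union of
the translates `c z + P_{s - z}`). -/
def fibrePts (a b : G → (Fin 2 → ℝ)) (r : G) : Set (Fin 2 → ℝ) :=
  Set.range fun x : G => a x + b (r - x)

/-- `V(P_r)`: the number of hull vertices of the fibre `P_r`. -/
noncomputable def fibreVert (a b : G → (Fin 2 → ℝ)) (r : G) : ℕ :=
  (Set.extremePoints ℝ (convexHull ℝ (fibrePts a b r))).ncard

/-- **The `n = 3` totals law with constant `C`** (conjecture-grade, OPEN): for every finite abelian group `G` and all curves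
`a b c : G → ℝ²`, the total class-hull vertex count is at most `C · |G|²`.  Census (NOTES-d1g3 §3, kit j298398): never above
`2.00 · |G|²`; both extreme regimes provably `≤ 2|G|²` (memo §2 L5).  Not asserted anywhere. -/
@[conjecture] def TotalsLawThree (C : ℕ) : Prop :=
  ∀ (G : Type) [AddCommGroup G] [Fintype G] (a b c : G → (Fin 2 → ℝ)), totalVert a b c ≤ C * Fintype.card G ^ 2

/-- **The sharp `n = 3` totals law** (conjecture-grade, OPEN; memo §3 "SHARP CONJECTURE (Q**, n=3)"): `T ≤ 2|G|² + C|G|`,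
extremisers being the two regimes of memo §2 L5 (third curve negligible: every class is the pair-sumset hull, `≤ 2q` each;
third curve a huge convex polygon: `∑_r V(P_r) + q²`).  Not asserted anywhere. -/
@[conjecture] def SharpTotalsLawThree (C : ℕ) : Prop :=
  ∀ (G : Type) [AddCommGroup G] [Fintype G] (a b c : G → (Fin 2 → ℝ)),
    totalVert a b c ≤ 2 * Fintype.card G ^ 2 + C * Fintype.card G

/-- The literal (Q**) case of the totals law: cyclic label group `ZMod q`. (OPEN; not asserted.) -/
@[conjecture] def TotalsLawThreeCyclic (C : ℕ) : Prop :=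
  ∀ (q : ℕ) [NeZero q] (a b c : ZMod q → (Fin 2 → ℝ)), totalVert a b c ≤ C * q ^ 2

/-! ### The trivial envelope (so that the statements are visibly non-vacuous) -/

omit [AddCommGroup G] in
/-- A range over a finite type has `ncard` at most the cardinality of the type. [folklore] -/
theorem ncard_range_le_card {β : Type*} (f : G → β) : (Set.range f).ncard ≤ Fintype.card G := by
  classical
  have h : Set.range f = ((Finset.univ.image f : Finset β) : Set β) := by ext y; simp
  rw [h, Set.ncard_coe_finset]
  exact Finset.card_image_le.trans (by simp)

/-- The class `s` has at most `|G|²` points, hence at most `|G|²` hull vertices: `V_s ≤ |G|²`. [folklore] -/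
theorem classVert_le_card_sq (a b c : G → (Fin 2 → ℝ)) (s : G) : classVert a b c s ≤ Fintype.card G ^ 2 := by
  classical
  unfold classVert
  have hfin : (classPts a b c s).Finite := Set.finite_range _
  calc (Set.extremePoints ℝ (convexHull ℝ (classPts a b c s))).ncard
      ≤ (classPts a b c s).ncard := Set.ncard_le_ncard extremePoints_convexHull_subset hfin
    _ ≤ Fintype.card (G × G) := ncard_range_le_card _
    _ = Fintype.card G ^ 2 := by rw [Fintype.card_prod, sq]

/-- The trivial totals bound `T ≤ |G|³`. [folklore] -/
theorem totalVert_le_card_cube (a b c : G → (Fin 2 → ℝ)) : totalVert a b c ≤ Fintype.card G ^ 3 := by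
  unfold totalVert
  calc ∑ s, classVert a b c s ≤ ∑ _s : G, Fintype.card G ^ 2 :=
        Finset.sum_le_sum fun s _ => classVert_le_card_sq a b c s
    _ = Fintype.card G ^ 3 := by rw [Finset.sum_const, Finset.card_univ, smul_eq_mul]; ring

/-- A fibre has at most `|G|` points, hence `V(P_r) ≤ |G|` (so the `n = 2` totals are `≤ |G|²` for free). [folklore] -/
theorem fibreVert_le_card (a b : G → (Fin 2 → ℝ)) (r : G) : fibreVert a b r ≤ Fintype.card G := by
  unfold fibreVert
  have hfin : (fibrePts a b r).Finite := Set.finite_range _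
  calc (Set.extremePoints ℝ (convexHull ℝ (fibrePts a b r))).ncard
      ≤ (fibrePts a b r).ncard := Set.ncard_le_ncard extremePoints_convexHull_subset hfin
    _ ≤ Fintype.card G := ncard_range_le_card _

omit [Fintype G] in
/-- The class is the union over `z` of the translated fibres `c z + P_{s - z}` (memo §2 L1, the union/Minkowski recursion at
`n = 3`). [folklore] -/
theorem classPts_eq_iUnion_fibre (a b c : G → (Fin 2 → ℝ)) (s : G) :
    classPts a b c s = ⋃ z : G, (fun p => c z + p) '' fibrePts a b (s - z) := by
  ext p
  simp only [classPts, fibrePts, Set.mem_range, Set.mem_iUnion, Set.mem_image, Prod.exists]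
  constructor
  · rintro ⟨x, y, rfl⟩
    exact ⟨s - x - y, a x + b y, ⟨x, by rw [show s - (s - x - y) - x = y by abel]⟩, by abel⟩
  · rintro ⟨z, _, ⟨x, rfl⟩, rfl⟩
    exact ⟨x, s - z - x, by rw [show s - x - (s - z - x) = z by abel]; abel⟩

/-- The general totals law implies its cyclic (literal (Q**)) case. -/
theorem totalsLawThree_imp_cyclic (C : ℕ) (h : TotalsLawThree C) : TotalsLawThreeCyclic C := by
  intro q _ a b c
  simpa [ZMod.card] using h (ZMod q) a b c

omit [AddCommGroup G] in
/-- `|G| ≤ |G|²`. [folklore] -/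
theorem card_le_card_sq : Fintype.card G ≤ Fintype.card G ^ 2 := by
  rcases Nat.eq_zero_or_pos (Fintype.card G) with h0 | hpos
  · simp [h0]
  · calc Fintype.card G = Fintype.card G * 1 := (mul_one _).symm
      _ ≤ Fintype.card G * Fintype.card G := Nat.mul_le_mul_left _ hpos
      _ = Fintype.card G ^ 2 := (sq _).symm

/-- The sharp law implies the weak law with constant `C + 2`. -/
theorem sharp_imp_weak (C : ℕ) (h : SharpTotalsLawThree C) : TotalsLawThree (C + 2) := by
  intro G _ _ a b c
  have hq : Fintype.card G ≤ Fintype.card G ^ 2 := card_le_card_sq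
  calc totalVert a b c ≤ 2 * Fintype.card G ^ 2 + C * Fintype.card G := h G a b c
    _ ≤ 2 * Fintype.card G ^ 2 + C * Fintype.card G ^ 2 := by gcongr
    _ = (C + 2) * Fintype.card G ^ 2 := by ring

/-! ### Symmetries of the class (the three pair systems `P, Q, R` play identical roles) -/

omit [Fintype G] in
/-- Cyclic symmetry of the class point set: `class(a,b,c) s = class(b,c,a) s`. [folklore] -/
theorem classPts_rotate (a b c : G → (Fin 2 → ℝ)) (s : G) : classPts a b c s = classPts b c a s := by
  ext p
  simp only [classPts, Set.mem_range, Prod.exists]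
  constructor
  · rintro ⟨x, y, rfl⟩
    exact ⟨y, s - x - y, by rw [show s - y - (s - x - y) = x by abel]; abel⟩
  · rintro ⟨y, z, rfl⟩
    exact ⟨s - y - z, y, by rw [show s - (s - y - z) - y = z by abel]; abel⟩

omit [Fintype G] in
/-- Transposition symmetry of the class point set: `class(a,b,c) s = class(b,a,c) s`. [folklore] -/
theorem classPts_swap (a b c : G → (Fin 2 → ℝ)) (s : G) : classPts a b c s = classPts b a c s := by
  ext p
  simp only [classPts, Set.mem_range, Prod.exists]
  constructor
  · rintro ⟨x, y, rfl⟩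
    exact ⟨y, x, by rw [sub_sub, sub_sub, add_comm y x, add_comm (b y) (a x)]⟩
  · rintro ⟨y, x, rfl⟩
    exact ⟨x, y, by rw [sub_sub, sub_sub, add_comm x y, add_comm (a x) (b y)]⟩

/-- `T(a,b,c) = T(b,c,a)`. [folklore] -/
theorem totalVert_rotate (a b c : G → (Fin 2 → ℝ)) : totalVert a b c = totalVert b c a := by
  unfold totalVert classVert
  simp_rw [classPts_rotate a b c]

/-- `T(a,b,c) = T(b,a,c)`. [folklore] -/
theorem totalVert_swap (a b c : G → (Fin 2 → ℝ)) : totalVert a b c = totalVert b a c := by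
  unfold totalVert classVert
  simp_rw [classPts_swap a b c]

/-! ### Memo §2 L1 at `n = 3`: a class has at most `∑_r V(P_r) + |G|` vertices

The class is the union of the `|G|` translated fibres `c z + P_{s-z}`; a vertex of the hull of a union is a vertex of the hull
of its own part (`KPTT.PlanarMinkowski.extremePoints_convexHull_biUnion_subset`), and a translate `{c z} + P` has at most
`1 + V(P)` vertices (`KPTT.PlanarMinkowski.ncard_extremePoints_add_le`, the planar Minkowski vertex bound of the tree).  Summing
over the classes gives only `T ≤ |G|·∑_r V(P_r) + |G|² ≤ |G|³ + |G|²` — the recursion loses the factor `|G|` per level exactly as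
Theorem Q does, which is why a TOTALS law is the statement to prove. -/

/-- The fibre total `∑_r V(P_r)` of the pair system of `a, b` (so `V_P = fibreTotal a b`, `V_Q = fibreTotal b c`,
`V_R = fibreTotal a c`). -/
noncomputable def fibreTotal (a b : G → (Fin 2 → ℝ)) : ℕ := ∑ r, fibreVert a b r

/-- `∑_r V(P_r) ≤ |G|²` (the `n = 2` totals). [folklore] -/
theorem fibreTotal_le_card_sq (a b : G → (Fin 2 → ℝ)) : fibreTotal a b ≤ Fintype.card G ^ 2 := by
  unfold fibreTotal
  calc ∑ r, fibreVert a b r ≤ ∑ _r : G, Fintype.card G := Finset.sum_le_sum fun r _ => fibreVert_le_card a b r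
    _ = Fintype.card G ^ 2 := by rw [Finset.sum_const, Finset.card_univ, smul_eq_mul, sq]

/-- **Memo L1 (`n = 3`).**  `V_s ≤ ∑_r V(P_r) + |G|`: the class is the union over `z` of the translates `c z + P_{s - z}`, each
of which has at most `V(P_{s-z}) + 1` hull vertices. [folklore] -/
theorem classVert_le_fibreTotal_add_card (a b c : G → (Fin 2 → ℝ)) (s : G) :
    classVert a b c s ≤ fibreTotal a b + Fintype.card G := by
  classical
  -- Finset models of the fibres and of their translates
  set P : G → Finset (Fin 2 → ℝ) := fun r => Finset.univ.image fun x : G => a x + b (r - x) with hP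
  set F : G → Finset (Fin 2 → ℝ) := fun z => ({c z} : Finset (Fin 2 → ℝ)) + P (s - z) with hF
  have hPcoe : ∀ r, (P r : Set (Fin 2 → ℝ)) = fibrePts a b r := by
    intro r
    rw [hP, Finset.coe_image, Finset.coe_univ, Set.image_univ]
    rfl
  have hclass : classPts a b c s = ((Finset.univ.biUnion F : Finset (Fin 2 → ℝ)) : Set (Fin 2 → ℝ)) := by
    rw [classPts_eq_iUnion_fibre, Finset.coe_biUnion]
    simp only [Finset.coe_univ, Set.mem_univ, Set.iUnion_true]
    refine Set.iUnion_congr fun z => ?_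
    rw [hF]
    dsimp only
    rw [Finset.coe_add, Finset.coe_singleton, ← hPcoe, Set.singleton_add]
  have hne : ∀ r, (P r).Nonempty := fun r => ⟨a 0 + b (r - 0), Finset.mem_image.2 ⟨0, Finset.mem_univ _, rfl⟩⟩
  unfold classVert
  rw [hclass]
  refine (Literature.Computability.AlgebraicComplexity.KPTT.PlanarMinkowski.ncard_extremePoints_biUnion_le
    Finset.univ F).trans ?_
  -- each translate: `V({c z} + P) ≤ 1 + V(P)`
  have hz : ∀ z, ((convexHull ℝ (F z : Set (Fin 2 → ℝ))).extremePoints ℝ).ncard ≤ 1 + fibreVert a b (s - z) := by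
    intro z
    refine (Literature.Computability.AlgebraicComplexity.KPTT.PlanarMinkowski.ncard_extremePoints_add_le
      (Finset.singleton_nonempty (c z)) (hne (s - z))).trans ?_
    have h1 : ((convexHull ℝ (({c z} : Finset (Fin 2 → ℝ)) : Set (Fin 2 → ℝ))).extremePoints ℝ).ncard ≤ 1 :=
      (Literature.Computability.AlgebraicComplexity.KPTT.PlanarMinkowski.ncard_extremePoints_le_card _).trans
        (by rw [Finset.card_singleton])
    have h2 : ((convexHull ℝ (P (s - z) : Set (Fin 2 → ℝ))).extremePoints ℝ).ncard = fibreVert a b (s - z) := by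
      rw [hPcoe]; rfl
    rw [h2]
    exact Nat.add_le_add_right h1 _
  calc ∑ z, ((convexHull ℝ (F z : Set (Fin 2 → ℝ))).extremePoints ℝ).ncard
      ≤ ∑ z, (1 + fibreVert a b (s - z)) := Finset.sum_le_sum fun z _ => hz z
    _ = Fintype.card G + ∑ z, fibreVert a b (s - z) := by
        rw [Finset.sum_add_distrib, Finset.sum_const, Finset.card_univ, smul_eq_mul, mul_one]
    _ = Fintype.card G + fibreTotal a b := by
        unfold fibreTotal
        rw [← Equiv.sum_comp (Equiv.subLeft s) (fibreVert a b)]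
        rfl
    _ = fibreTotal a b + Fintype.card G := Nat.add_comm _ _

/-- **`T ≤ |G|·(∑_r V(P_r) + |G|)`** — the Theorem-Q-shaped consequence of L1 (cubic, one factor `|G|` lost); the totals law
asks for `|G|²` instead. [folklore] -/
theorem totalVert_le_card_mul (a b c : G → (Fin 2 → ℝ)) :
    totalVert a b c ≤ Fintype.card G * (fibreTotal a b + Fintype.card G) := by
  unfold totalVert
  calc ∑ s, classVert a b c s ≤ ∑ _s : G, (fibreTotal a b + Fintype.card G) :=
        Finset.sum_le_sum fun s _ => classVert_le_fibreTotal_add_card a b c s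
    _ = Fintype.card G * (fibreTotal a b + Fintype.card G) := by
        rw [Finset.sum_const, Finset.card_univ, smul_eq_mul]

/-- L1 through the `Q`-system: `V_s ≤ ∑_t V(Q_t) + |G|` (`Q_t = {b y + c z : y + z = t}`). [folklore] -/
theorem classVert_le_fibreTotal_bc_add_card (a b c : G → (Fin 2 → ℝ)) (s : G) :
    classVert a b c s ≤ fibreTotal b c + Fintype.card G := by
  have h := classVert_le_fibreTotal_add_card b c a s
  unfold classVert at h ⊢
  rwa [← classPts_rotate a b c s] at h

/-- L1 through the `R`-system: `V_s ≤ ∑_u V(R_u) + |G|` (`R_u = {a x + c z : x + z = u}`; note `fibreTotal c a`, the same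
fibres as `{a x + c (u - x)}` up to the order of summation). [folklore] -/
theorem classVert_le_fibreTotal_ca_add_card (a b c : G → (Fin 2 → ℝ)) (s : G) :
    classVert a b c s ≤ fibreTotal c a + Fintype.card G := by
  have h := classVert_le_fibreTotal_add_card c a b s
  unfold classVert at h ⊢
  rwa [classPts_rotate c a b s] at h

/-! ### Sanity regime: a degenerate (constant) third curve

The `c`-negligible end of memo §2 L5 in its exact degenerate form: if `c` is constant every class is the translate
`(A + B) + c₀` of the full pair sumset, so `V_s ≤ V(A) + V(B) + 1 ≤ 2|G| + 1` by the planar Minkowski bound, and `T ≤ 2|G|² + |G|`: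
the sharp law with `C = 1` holds on this stratum. -/

/-- With a constant third curve the class is the translated pair sumset `{c₀} + (A + B)`. [folklore] -/
theorem classPts_const (a b : G → (Fin 2 → ℝ)) (c₀ : Fin 2 → ℝ) (s : G) [DecidableEq (Fin 2 → ℝ)] :
    classPts a b (fun _ => c₀) s =
      ((({c₀} : Finset (Fin 2 → ℝ)) + (Finset.univ.image a + Finset.univ.image b) : Finset (Fin 2 → ℝ)) :
        Set (Fin 2 → ℝ)) := by
  ext p
  simp only [classPts, Set.mem_range, Prod.exists, Finset.coe_add, Finset.coe_singleton, Finset.coe_image,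
    Finset.coe_univ, Set.image_univ, Set.singleton_add, Set.mem_image, Set.mem_add, Set.mem_range]
  constructor
  · rintro ⟨x, y, rfl⟩
    exact ⟨a x + b y, ⟨a x, ⟨x, rfl⟩, b y, ⟨y, rfl⟩, rfl⟩, by abel⟩
  · rintro ⟨_, ⟨_, ⟨x, rfl⟩, _, ⟨y, rfl⟩, rfl⟩, rfl⟩
    exact ⟨x, y, by abel⟩

/-- **Constant third curve: `V_s ≤ 2|G| + 1`.** [folklore] -/
theorem classVert_const_le (a b : G → (Fin 2 → ℝ)) (c₀ : Fin 2 → ℝ) (s : G) :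
    classVert a b (fun _ => c₀) s ≤ 2 * Fintype.card G + 1 := by
  classical
  have hA : (Finset.univ.image a : Finset (Fin 2 → ℝ)).Nonempty := ⟨a 0, Finset.mem_image.2 ⟨0, Finset.mem_univ _, rfl⟩⟩
  have hB : (Finset.univ.image b : Finset (Fin 2 → ℝ)).Nonempty := ⟨b 0, Finset.mem_image.2 ⟨0, Finset.mem_univ _, rfl⟩⟩
  unfold classVert
  rw [classPts_const a b c₀ s]
  calc ((convexHull ℝ (((({c₀} : Finset (Fin 2 → ℝ)) + (Finset.univ.image a + Finset.univ.image b) :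
          Finset (Fin 2 → ℝ)) : Set (Fin 2 → ℝ)))).extremePoints ℝ).ncard
      ≤ ((convexHull ℝ ((({c₀} : Finset (Fin 2 → ℝ))) : Set (Fin 2 → ℝ))).extremePoints ℝ).ncard +
          ((convexHull ℝ (((Finset.univ.image a + Finset.univ.image b : Finset (Fin 2 → ℝ))) :
            Set (Fin 2 → ℝ))).extremePoints ℝ).ncard :=
        Literature.Computability.AlgebraicComplexity.KPTT.PlanarMinkowski.ncard_extremePoints_add_le
          (Finset.singleton_nonempty c₀) (hA.add hB)
    _ ≤ 1 + (Fintype.card G + Fintype.card G) := by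
        gcongr
        · exact (Literature.Computability.AlgebraicComplexity.KPTT.PlanarMinkowski.ncard_extremePoints_le_card _).trans
            (by rw [Finset.card_singleton])
        · refine (Literature.Computability.AlgebraicComplexity.KPTT.PlanarMinkowski.ncard_extremePoints_add_le hA hB).trans ?_
          gcongr
          · exact (Literature.Computability.AlgebraicComplexity.KPTT.PlanarMinkowski.ncard_extremePoints_le_card _).trans
              (Finset.card_image_le.trans (by rw [Finset.card_univ]))
          · exact (Literature.Computability.AlgebraicComplexity.KPTT.PlanarMinkowski.ncard_extremePoints_le_card _).trans
              (Finset.card_image_le.trans (by rw [Finset.card_univ]))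
    _ = 2 * Fintype.card G + 1 := by ring

/-- **Constant third curve: the sharp law with `C = 1` on this stratum, `T ≤ 2|G|² + |G|`.** [folklore] -/
theorem totalVert_const_le (a b : G → (Fin 2 → ℝ)) (c₀ : Fin 2 → ℝ) :
    totalVert a b (fun _ => c₀) ≤ 2 * Fintype.card G ^ 2 + Fintype.card G := by
  unfold totalVert
  calc ∑ s, classVert a b (fun _ => c₀) s ≤ ∑ _s : G, (2 * Fintype.card G + 1) :=
        Finset.sum_le_sum fun s _ => classVert_const_le a b c₀ s
    _ = 2 * Fintype.card G ^ 2 + Fintype.card G := by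
        rw [Finset.sum_const, Finset.card_univ, smul_eq_mul]; ring

/-! ### Memo §2 L5, the averaging lemma (full multiplicity forces a top fibre)

At a fixed direction write `g r` for the support value of the fibre `P_r` and `γ z` for that of the letter `c z`; the fibre `r₀`
placed at `c (s - r₀)` carries the maximum of class `s` iff `g r + γ (s - r) ≤ g r₀ + γ (s - r₀)` for all `r`.  Summing this over a
set `Z` of classes and using that `∑_{s ∈ G} γ (s - r)` does not depend on `r` gives the multiplicity inequality, and for `Z = G`
that `r₀` is a top fibre.  Pure bookkeeping over the group; the geometric instantiation is by `⟨θ, ·⟩`. -/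

omit [Fintype G] in
/-- **Averaging inequality.**  If the fibre `r₀` carries the maximum of every class `s ∈ Z`, then for every fibre `r`,
`∑_{s∈Z} (γ (s - r) - γ (s - r₀)) ≤ |Z| · (g r₀ - g r)`. [folklore] -/
theorem sum_sub_le_card_mul_of_wins (g γ : G → ℝ) (r₀ : G) (Z : Finset G)
    (hwin : ∀ s ∈ Z, ∀ r, g r + γ (s - r) ≤ g r₀ + γ (s - r₀)) (r : G) :
    ∑ s ∈ Z, (γ (s - r) - γ (s - r₀)) ≤ Z.card * (g r₀ - g r) := by
  calc ∑ s ∈ Z, (γ (s - r) - γ (s - r₀)) ≤ ∑ _s ∈ Z, (g r₀ - g r) :=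
        Finset.sum_le_sum fun s hs => by linarith [hwin s hs r]
    _ = Z.card * (g r₀ - g r) := by rw [Finset.sum_const, nsmul_eq_mul]

/-- **Memo L5 (full multiplicity ⇒ top fibre).**  If the fibre `r₀` carries the maximum of EVERY class, then `g r ≤ g r₀` for
every fibre `r`: the `γ`-sums over all classes cancel by translation invariance of `∑_{s∈G}`. [folklore] -/
theorem le_of_wins_all (g γ : G → ℝ) (r₀ : G) (hwin : ∀ s r, g r + γ (s - r) ≤ g r₀ + γ (s - r₀)) (r : G) :
    g r ≤ g r₀ := by
  have hsum : ∑ s, (γ (s - r) - γ (s - r₀)) = 0 := by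
    rw [Finset.sum_sub_distrib]
    have h1 : ∑ s, γ (s - r) = ∑ s, γ s := Equiv.sum_comp (Equiv.subRight r) γ
    have h2 : ∑ s, γ (s - r₀) = ∑ s, γ s := Equiv.sum_comp (Equiv.subRight r₀) γ
    rw [h1, h2, sub_self]
  have h := sum_sub_le_card_mul_of_wins g γ r₀ Finset.univ (fun s _ r => hwin s r) r
  rw [hsum, Finset.card_univ] at h
  have hpos : (0 : ℝ) < Fintype.card G := by exact_mod_cast Fintype.card_pos
  nlinarith

/-! ### A sharper typed conjecture: the three fibre totals dominate (explicit constant)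

`3·T = ∑` over ALL fibre vertices `v` of the three pair systems of the number of exposed words through `v`, so
`T ≤ V_P + V_Q + V_R` says "average multiplicity `≤ 3`".  Census of this session (local exact hulls, `exp/anneal2.py`; adversarial
annealing of `T − (V_P+V_Q+V_R)` over integer and multi-scale real configurations with label permutations, `q = 5…10`, 24 runs of
`4·10⁴–2.6·10⁵` steps; structured families: both regimes (`T = 2q²` vs `3q²`), parabola gadget (`q = 17`: 338 vs 464), three
parabolas, random clouds, collinear fibres `a = b = c` regular (`T = 3q`, `S = 6q`)): the slack-free form `C = 0` was NEVER violated,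
closest approach `T = S − 2` at `q = 8` (adversarial; the gap does not grow with `q` there, so `C = 0` is census-sharp and the
honest typed form carries an `O(q)` slack).  OPEN; implies the weak law with constant `C + 3`. -/

/-- **Fibre-sum dominance with slack `C`** (conjecture-grade, OPEN; this session's census supports `C = 0` for `q ≤ 10`):
`T(a,b,c) ≤ ∑_r V(P_r) + ∑_t V(Q_t) + ∑_u V(R_u) + C·|G|` where `P, Q, R` are the fibre systems of the pair sumsets `a+b`, `b+c`,
`c+a`.  Not asserted anywhere. -/
@[conjecture] def FibreSumDominance (C : ℕ) : Prop :=
  ∀ (G : Type) [AddCommGroup G] [Fintype G] (a b c : G → (Fin 2 → ℝ)),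
    totalVert a b c ≤ fibreTotal a b + fibreTotal b c + fibreTotal c a + C * Fintype.card G

/-- Fibre-sum dominance with slack `C` implies the weak totals law with the explicit constant `C + 3`. -/
theorem fibreSumDominance_imp_totalsLawThree (C : ℕ) : FibreSumDominance C → TotalsLawThree (C + 3) := by
  intro h G _ _ a b c
  have hq : Fintype.card G ≤ Fintype.card G ^ 2 := card_le_card_sq
  calc totalVert a b c ≤ fibreTotal a b + fibreTotal b c + fibreTotal c a + C * Fintype.card G := h G a b c
    _ ≤ Fintype.card G ^ 2 + Fintype.card G ^ 2 + Fintype.card G ^ 2 + C * Fintype.card G ^ 2 := by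
        gcongr <;> exact fibreTotal_le_card_sq _ _
    _ = (C + 3) * Fintype.card G ^ 2 := by ring

end TotalsLaw

end Summit.ValiantsHypothesis.ValiantsHypothesis.Theorems.NewtonUnitEquationsDissociatedUniform
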